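/-
Copyright (c) 2026 the pub-hodgecm-mathlib formalisation cell (harness21).  Prover seat hodgecm-mathlib-F0P3a-p01 (g19): line LH1 «ZENTRUM»
CENTRAL-ι sub-leaf (chair LH1-plan (g4)), organ (B4) O-SPLIT — SB5 assembly; 2026-09-02.
-/
import Summits.HodgeConjecture.HodgeConjecture.Theorems.F0P3cXiCentralIotaOfOrgans          -- ★ p850019 (B0): the organ letter `XiCentralCharSplitLetter`
import Summits.HodgeConjecture.HodgeConjecture.Theorems.F0P3cStCharTSPrincipalSeriesCentral  -- ★ p849775: `apply_eq_smul_of_isConstituentOf`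
import Literature.NumberTheory.Automorphic.DiscreteAutomorphicRepFinSmoothVector              -- ★ p850020 (LH1-p01 (g4)): FIN-SMOOTH-NE-BOT
import Literature.NumberTheory.Automorphic.ParabolicIndGLLeviCharCentral                      -- SB2 (this seat, p850029): `splitMemberGL_apply_of_coe_eq_smul_one`
import Literature.NumberTheory.Automorphic.UnitaryGroupLocalScalarAdelicCenter                    -- ★ p850057 SB3 (F0P2-p01 (g18)): the (Z2b) identity + split reading
import Literature.NumberTheory.Rogawski1990.OneDimAutRepHSplitTorusDictionary                      -- ★ p850051 SB4 (LH1-p03 (g3)): `η²ψ³μ(loc t) = ν₀(a)²χ′(a)`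
import HarnessLib

/-!
# F0 · P3c · line LH1 «ZENTRUM» — organ (B4) O-SPLIT «ZENTRUM-SPLIT»: the central character of `P` at a split place is `η² ψ³ μ` there

Cell `pub/hodgecm-mathlib`, crux H413 = `stmt-HodgeConjecture-24833` (`--supports` lane), route HCCMUnconditional; prover F0P3a-p01 (g19) on LH1-plan (g4)'s
by-name deal «(B4) O-SPLIT» of the «ZENTRUM» CENTRAL-ι sub-leaf (★ p850019 `Theorems/F0P3cXiCentralIotaOfOrgans`, whose PROVED head
`s2CentralIota_of_organs (hS : XiCentralCharSplitLetter)` has this organ as its ONE hypothesis).  THEOREMS ONLY (no `def`, no instance, no notation,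
no named fact, no `sorry`).

THE STATEMENT (★ `F0P3cXiCentralIotaOfOrgans.XiCentralCharSplitLetter`, proved here BY NAME as `xiCentralCharSplit`): for a discrete automorphic
`P` of the inner form `U(H)` in the ξ-family (★ `MemXiFamily`), any character `ψ` of `U(1)(𝔸_{L⁺})` through which the adèlic centre acts on `P`
(★ `adelicCenter`), every place `v` of `L⁺` SPLIT in `L` and every `t ∈ T(L⁺_v) = U(1)(L⁺_v)`:
`ψ(t) = η(t)² · ψ_ξ(t)³ · μω(t)` (the local torus element read in `U(1)(𝔸)` by ★ `locTorusIncl` ∕ ★ `adelicOneEquivTorus`).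

THE PROOF (an assembly of ★ bricks, [Rogawski1990, §12.2 p. 173 «the constituents of `i_G(χ)` have central character `χ|_Z`»; §13.3 p. 201;
Lemma 4.13.1 (b)]):
1. a local constituent `c′` of `P|_{U(H)(L⁺_v)}` EXISTS (★ p850020 `exists_comap_isConstituentOf_finRep_smoothPart_comp_inclPlace_and_cm`, LH1-p01 (g4):
   Alaoglu–Birkhoff non-zero smooth vector of any discrete automorphic `P`) and is a MEMBER of `Pv v` (★ `LocalConstituentsIn`), which at a split `v` is the
   singleton `{⟦i_G(ξ_w) ∘ cmSplitEquiv⟧}` (★ `IsXiLocalFamily.eq_cmSplitPacket`, ★ `LocalAPacket.members_of_πs_eq_none`, ★ `cmSplitPacket_πn`),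
   `w = splitWitness v hs`, labels `ν₀ = ξ.splitν₀ μω w = η_w ψ_w μ_w`, `χ′ = ξ.locψ w = ψ_w`;
2. the central scalar `z = t·1₃ ∈ U(H)(L⁺_v)` (★ p850057 SB3 `exists_local_coe_eq_smul_one`, F0P2-p01 (g18)) acts on `P|_{U(H)(L⁺_v)}` by `ψ(u_t)`,
   `u_t ↔ locTorusIncl v t`, because `inclPlaceAdelic v z = adelicCenter u_t` (★ SB3 `inclPlaceAdelic_localPiEquiv_symm_of_coe_eq_smul_one`) and `hψ`;
   the scalar descends to every representative of the constituent class (★ p849775 `apply_eq_smul_of_isConstituentOf`);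
3. on the representative `i_G(ξ_w) ∘ cmSplitEquiv` the same `z` acts by `ν₀(a)²χ′(a)`, `a = t_w` (★ SB3 `coe_localSplitEquiv_of_coe_eq_smul_one`:
   `cmSplitEquiv z = a·1₃`; ★ p850029 SB2 `splitMemberGL_apply_of_coe_eq_smul_one`, this seat: central character of the degenerate principal series);
4. two scalars on one non-zero irreducible space agree (★ `IrrClass.nontrivial_of_isIrreducible`), and ★ p850051 SB4
   `OneDimAutRepH.eta_sq_psi_cube_mu_locTorusIncl_eq` (LH1-p03 (g3)) rewrites `ν₀(a)²χ′(a)` as `η(t)²ψ_ξ(t)³μω(t)`.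
HONEST LABEL: HC_CM is proved only modulo the 2 remaining named inputs (hLiu418 24832, h413 24833) until rung 0 closes; count-neutral (LH1 «ZENTRUM»
pays the CENTRAL-ι half of the archimedean pin of #80 in-house; no books digit moves until LH1 LEAF ED. 3 is written).

## References
* [Rogawski1990] J. Rogawski, *Automorphic Representations of Unitary Groups in Three Variables*, Ann. of Math. Stud. 123 (1990), §4.13 p. 62,
  Lemma 4.13.1 (b) p. 64; §12.2 p. 173; §13.1 p. 199; §13.3 p. 201.
* [BorelJacquet1979] A. Borel, H. Jacquet, *Automorphic forms and automorphic representations*, PSPM 33.1 (1979), §4.6.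
* [BushnellHenniart2006] C. Bushnell, G. Henniart, *The local Langlands conjecture for GL(2)* (2006), §1.1, §2.6.
-/

set_option autoImplicit false
set_option linter.dupNamespace false

noncomputable section

open NumberField IsDedekindDomain MeasureTheory
open scoped Matrix

namespace Summit.HodgeConjecture.HodgeConjecture.Cruxes.H413.F0P3cXiCentralCharSplit

open Literature.NumberTheory.Automorphic Literature.NumberTheory.Automorphic.UnitaryGroup
open Literature.NumberTheory.GaloisRepresentations
open Literature.NumberTheory.Automorphic.Arthur2013.Leaves.TECR
open Literature.NumberTheory.Rogawski1990
open Summit.HodgeConjecture.HodgeConjecture.Cruxes.H413.F0P3cXiCentralIotaOfOrgans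
open Summit.HodgeConjecture.HodgeConjecture.Cruxes.H413.F0P3cStCharTSPrincipalSeriesCentral (apply_eq_smul_of_isConstituentOf)

/-! ## The organ (B4) O-SPLIT, proved -/

set_option maxHeartbeats 800000 in
-- budget: the organ frame (`MemXiFamily`, `cmSplitPacket` labels) is statement-heavy; the proof is a composition, no search.
/-- **O-SPLIT «ZENTRUM-SPLIT» (organ (B4) of the CENTRAL-ι sub-leaf):** for `P` in the ξ-family and any character `ψ` through which the adèlic
centre acts on `P`, at every split `v` and every `t ∈ T(L⁺_v)`: `ψ(t) = η(t)² · ψ_ξ(t)³ · μ(t)`.  PROOF: a local constituent `c′` of `P` at `v` exists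
(★ p850020, Alaoglu–Birkhoff smooth vector) and lies in `Pv v = {i_G(ξ_w) ∘ cmSplitEquiv}` (★ `MemXiFamily`, ★ `eq_cmSplitPacket`); the central
scalar `z = t·1₃` acts on `P|_{U(H)(L⁺_v)}` by `ψ(u_t)` ((Z2b) ★ SB3 + `hψ`), hence on the constituent (★ p849775 descent); on `i_G(ξ_w)` it acts by
`ν₀(t_w)²χ′(t_w)` (★ SB2 + SB3 (c)); two scalars on one non-zero irreducible space agree; ★ SB4 rewrites `ν₀²χ′` as `η²ψ³μ`.
[cite: Rogawski1990, Lemma 4.13.1 (b) p. 64; §12.2 p. 173; §13.3 p. 201] [cite: BorelJacquet1979, §4.6] -/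
theorem xiCentralCharSplit : XiCentralCharSplitLetter := by
  intro L _ _ _ ι H T hT _hdef _h2 μ _ μω hμu hquad P _hP ψ hψ ξ hξ v hs t
  classical
  obtain ⟨Pv, hfam, hPv⟩ := hξ
  -- the fixed split witness `w ∣ v`, the `w`-component `a = t_w`, the labels `ν₀ = η_w ψ_w μ_w`, `χ′ = ψ_w` of the split packet
  set w : PlacesOver L v := splitWitness v hs with hw_def
  have hw : IsCMField.complexConj L • w.1 ≠ w.1 := splitWitness_spec v hs
  set a : (w.1.adicCompletion L)ˣ := MulEquiv.piUnits (t : (LocalRing L v)ˣ) w with ha_def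
  set ν₀ : (w.1.adicCompletion L)ˣ →* ℂˣ := ξ.splitν₀ μω w.1 with hν₀_def
  set χ' : (w.1.adicCompletion L)ˣ →* ℂˣ := ξ.locψ w.1 with hχ'_def
  -- a local constituent of `P` at `v`, member of `Pv v = {πⁿ} = {⟦i_G(ξ_w) ∘ cmSplitEquiv⟧}`
  obtain ⟨c', hc', hmem⟩ := P.exists_comap_isConstituentOf_finRep_smoothPart_comp_inclPlace_and_cm v (hPv v)
  rw [hfam.eq_cmSplitPacket v hs, LocalAPacket.members_of_πs_eq_none _ (cmSplitPacket_πs L H _ _ v _ hw _ _ _ _ _ _),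
    Set.mem_singleton_iff, cmSplitPacket_πn] at hmem
  subst hmem
  -- the pull-back `R = i_G(ξ_w) ∘ cmSplitEquiv` (the representative of the constituent class)
  set R : SmoothIrrep ((cmDatum L 3 H).Local v) :=
    (splitMemberGL (w.1.adicCompletion L) ν₀ χ' (ξ.norm_splitν₀_apply hμu w.1) (ξ.continuous_splitν₀ μω w.1)
      (ξ.norm_locψ_apply w.1) (ξ.continuous_locψ w.1)).comap
    (cmSplitEquiv L H (transpose_map_cmConjRingHom_eq_of_frame L ι H T hT) (isUnit_det_of_frame L ι H T hT) v w hw) with hR_def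
  -- the central scalar `z = t • 1 ∈ U(H)(L⁺_v)` (SB3 (a)) and its split reading `a • 1 ∈ GL₃(L_w)` (SB3 (c))
  obtain ⟨z, hz⟩ := UnitaryGroup.exists_local_coe_eq_smul_one L (IsCMField.complexConj L) H t
  have hzw : ((cmSplitEquiv L H (transpose_map_cmConjRingHom_eq_of_frame L ι H T hT) (isUnit_det_of_frame L ι H T hT) v w hw z :
      GL (Fin 3) (w.1.adicCompletion L)) : Matrix (Fin 3) (Fin 3) (w.1.adicCompletion L)) = (a : w.1.adicCompletion L) • 1 :=
    UnitaryGroup.coe_localSplitEquiv_of_coe_eq_smul_one L (IsCMField.complexConj L) H (IsCMField.complexConj_ne_one L)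
      ((UnitaryGroup.map_cmConjRingHom_eq_map_complexConj L H) ▸ transpose_map_cmConjRingHom_eq_of_frame L ι H T hT) w hw
      (UnitaryGroup.isUnit_placeForm_of_isUnit_det (isUnit_det_of_frame L ι H T hT) w.1) t z hz
  -- the scalar `ψ(u_t)` through which `z` acts on `P`
  set cψ : ℂ := (((ψ ((adelicOneEquivTorus (↥(maximalRealSubfield L)) L (IsCMField.complexConj L)).symm
      (locTorusIncl L (IsCMField.complexConj L) v t)) : ℂˣ) : ℂ)) with hcψ_def
  -- (i) `z` acts on `R` by `ν₀(a)² χ′(a)` (SB2: central character of the split member)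
  have hi : ∀ f : R.V, R.ρ z f = (((ν₀ a : ℂˣ) : ℂ) ^ 2 * ((χ' a : ℂˣ) : ℂ)) • f := fun f =>
    splitMemberGL_apply_of_coe_eq_smul_one ν₀ χ' (ξ.norm_splitν₀_apply hμu w.1) (ξ.continuous_splitν₀ μω w.1)
      (ξ.norm_locψ_apply w.1) (ξ.continuous_locψ w.1) a hzw f
  -- (ii) `z` acts on `R` by `ψ(u_t)`: the central action on `P|_{U(H)(L⁺_v)}` ((Z2b) = SB3 (b), then `hψ`) descends to the constituent
  have hsc : ∀ x : ↥(P.finRep.smoothPart.toSubmodule),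
      (P.finRep.smoothPart.toRepresentation.comp (inclPlace (↥(maximalRealSubfield L)) L (IsCMField.complexConj L) 3 H v))
        ((localPiEquiv L (IsCMField.complexConj L) 3 H v).symm z) x = cψ • x := fun x => by
    refine Subtype.ext ?_
    rw [Submodule.coe_smul]
    change P.space.toContRep (finAdelicToAdelic (↥(maximalRealSubfield L)) L (IsCMField.complexConj L) 3 H
      (inclPlace (↥(maximalRealSubfield L)) L (IsCMField.complexConj L) 3 H v ((localPiEquiv L (IsCMField.complexConj L) 3 H v).symm z)))
      (x : P.space.toSubmodule) = cψ • (x : P.space.toSubmodule)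
    rw [← inclPlaceAdelic_apply, UnitaryGroup.inclPlaceAdelic_localPiEquiv_symm_of_coe_eq_smul_one L (IsCMField.complexConj L) H t z hz, hψ]
  have hii : ∀ f : R.V, R.ρ z f = cψ • f := fun f => by
    have h := apply_eq_smul_of_isConstituentOf hsc (r := R.comap (localPiEquiv L (IsCMField.complexConj L) 3 H v)) hc' f
    rw [SmoothIrrep.comap_ρ_apply, ContinuousMulEquiv.apply_symm_apply] at h
    exact h
  -- two scalars on one non-zero irreducible space agree
  haveI : Nontrivial R.V := IrrClass.nontrivial_of_isIrreducible R.ρ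
  obtain ⟨f, hf⟩ := exists_ne (0 : R.V)
  have hscal : ((ν₀ a : ℂˣ) : ℂ) ^ 2 * ((χ' a : ℂˣ) : ℂ) = cψ := smul_left_injective ℂ hf ((hi f).symm.trans (hii f))
  -- rewrite the letter's right-hand side (SB4) and conclude in `ℂˣ`
  rw [OneDimAutRepH.eta_sq_psi_cube_mu_locTorusIncl_eq ξ μω hquad w hw t]
  refine Units.ext ?_
  rw [Units.val_mul, Units.val_pow_eq_pow_val]
  exact hscal.symm

end Summit.HodgeConjecture.HodgeConjecture.Cruxes.H413.F0P3cXiCentralCharSplit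

end
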